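import Literature.AlgebraicGeometry.Resolution.ReflexiveModulesRationalDoublePoints
import HarnessLib

/-!
# A Noetherian scheme has finitely many maximal points in each closed subset; the exceptional
# curves of a proper `X → Spec 𝒪` are finite in number

Topic: `Literature/AlgebraicGeometry/Resolution`. PROVED glue for the scheme-side vocabulary of
surface singularities (`Resolution/MaximalPoints`, `Resolution/ReflexiveModulesRationalDoublePoints`):

* `maxPoints_finite` — a closed subset `Z` of a Noetherian scheme has finitely many maximal points
  (generic points of its irreducible components): globalisation of the affine-local statement
  `finite_maxPoints_inter_of_isAffineOpen` (Stacks 0BA8) over a finite affine open cover of the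
  quasi-compact `X`.
* `excPoints_finite` — for `𝒪` a Noetherian local ring and `π : X → Spec 𝒪` proper, the set
  `excPoints π` of generic points of the components of the closed fibre is finite ("`C = ∪ C_i` the
  closed fibre of `π`", finitely many `C_i`: Artin–Verdier 1985, p. 79; Lipman 1969, §10: "the
  components of `C` are in one-one correspondence with the (finitely many) non-closed points of
  `C`").

## References

* The Stacks project, Tag 0BA8 (a Noetherian topological space has finitely many irreducible
  components). [StacksProject]
* J. Lipman, *Rational singularities …*, Publ. Math. IHÉS 36 (1969), §10 (p. 212). [Lipman1969]
-/

noncomputable section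

open CategoryTheory AlgebraicGeometry TopologicalSpace IsLocalRing

universe u

namespace Literature.AlgebraicGeometry.Resolution

/-- **A closed subset of a Noetherian scheme has finitely many maximal points** (the generic
points of its finitely many irreducible components; Stacks 0BA8), from the affine-local finiteness
`finite_maxPoints_inter_of_isAffineOpen` and a finite affine open cover of the quasi-compact `X`.
[cite: StacksProject, Tag 0BA8] -/
theorem maxPoints_finite {X : Scheme.{u}} [IsNoetherian X] {Z : Set X} (hZ : IsClosed Z) :
    (maxPoints Z).Finite := by
  -- a finite affine open cover of the compact space `X`
  let U := fun i => (X.affineCover.f i).opensRange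
  have hU : ∀ i, IsAffineOpen (U i) := fun i => isAffineOpen_opensRange _
  have hcov : (Set.univ : Set X) ⊆ ⋃ i, (U i : Set X) := fun x _ =>
    Set.mem_iUnion.2 ⟨X.affineCover.idx x, X.affineCover.covers x⟩
  obtain ⟨t, ht⟩ := isCompact_univ.elim_finite_subcover (fun i => (U i : Set X))
    (fun i => (U i).isOpen) hcov
  refine (t.finite_toSet.biUnion fun x _ => finite_maxPoints_inter_of_isAffineOpen (hU x) hZ).subset
    ?_
  intro η hη
  have hη' : η ∈ ⋃ x ∈ t, (U x : Set X) := ht (Set.mem_univ η)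
  simp only [Set.mem_iUnion] at hη' ⊢
  obtain ⟨x, hx, hηx⟩ := hη'
  exact ⟨x, hx, hη, hηx⟩

/-- **The closed fibre of a proper `π : X → Spec 𝒪` (`𝒪` Noetherian local) has finitely many
components**: `excPoints π` is finite. (`X` is Noetherian, being of finite type over `Spec 𝒪`,
and the closed fibre is closed.) [cite: Lipman1969, Section 10 (p. 212)] -/
theorem excPoints_finite {O : Type u} [CommRing O] [IsLocalRing O] [IsNoetherianRing O]
    {Xt : Scheme.{u}} (π : Xt ⟶ Spec (.of O)) [IsProper π] : (excPoints π).Finite := by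
  haveI : IsNoetherian Xt := by
    haveI : IsLocallyNoetherian Xt := LocallyOfFiniteType.isLocallyNoetherian π
    haveI : CompactSpace Xt := QuasiCompact.compactSpace_of_compactSpace π
    exact {}
  have hclosed : IsClosed ({closedPoint O} : Set (Spec (.of O))) :=
    (PrimeSpectrum.isClosed_singleton_iff_isMaximal (closedPoint O)).mpr
      (IsLocalRing.maximalIdeal.isMaximal O)
  exact maxPoints_finite (hclosed.preimage π.continuous)

end Literature.AlgebraicGeometry.Resolution

end
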